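import Summits.RiemannHypothesis.RiemannHypothesis.Theorems.SignConeConeMagnificationTranslate
import Summits.RiemannHypothesis.RiemannHypothesis.Theorems.SignConeExactConeRigidityPosDefLaplace
import Literature.NumberTheory.LFunctions.WeilExplicitContinuous

/-!
# Route SignCone, item `ExactConeRigidity` (stmt-RiemannHypothesis-16306): the Carathéodory positivity of
cone weights (archive 2001 fefr Thm A, Laplace form)

Let `c ≥ 0` be a weight on `ℕ` in a slack cone: for some real `κ` and EVERY Weil test `φ`,
`-κ‖φ‖₂² ≤ Re (W_ar - P_c)(φ ⋆ φ̃)` (`W_ar = weilPolarTerm + weilArchTerm`,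
`P_c(K) = Σₙ c(n) n^{-1/2}(K(log n) + K(-log n))`; `κ = 0` is the EXACT cone of this item, `κ = 1` the
unit-slack cone of `ConeMagnification`). For a Weil test `g` with autocorrelation `G = g ⋆ g̃` put

  `a(x) := (W_ar - P_c)(G(· - x)) + κ G(-x)`   (the `κ`-slack fake Weil form along the translates of `G`).

* `re_sum_sum_fakeForm_translate_nonneg` — `a` is POSITIVE-DEFINITE: `0 ≤ Re Σ_{j,k} z_j conj(z_k) a(x_j - x_k)`
  (the comb `Σ_j z_j g(· - x_j)` is a Weil test whose autocorrelation is `Σ_{j,k} z_j conj(z_k) G(· - x_j + x_k)`);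
* `fakeForm_translate_neg` — `a(-x) = conj a(x)`; `norm_fakeForm_translate_le` — `‖a(x)‖ ≤ Re a(0)` (the
  `γ`-trick of `SignCone.norm_fakeForm_weilTranslate_le`, here for every slack `κ`);
  `continuous_fakeForm_translate` — `a` is continuous;
* `re_laplace_fakeForm_translate_nonneg` — **CARATHÉODORY POSITIVITY**: `0 ≤ Re ∫₀^∞ a(x) e^{-zx} dx` for every
  `Re z > 0` (`re_laplace_nonneg_of_posDef`).

Since `∫₀^∞ a(x) e^{-zx} dx = M_G(1)/(z - 1/2) + (holomorphic on Re z > 0) - D_c(z + 1/2) M_G(z + 1/2)`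
(`D_c(s) = Σ c(n) n^{-s}`; the Laplace computation of the continuation step), this is the tree form of the 2001
"Carathéodory description" `Re (1/s + 1/(s-1) - ½ log π + ½ψ(s/2) - D_c(s)) ≥ -κ/2·(…)` of cone weights — the
structural input of every rigidity / deficit argument of the exact chain (W-COMP, W-SRPP, W-MAG).
-/

noncomputable section

-- `Summit.RiemannHypothesis.RiemannHypothesis.…` repeats a namespace component by design (D-0017 layout).
set_option linter.dupNamespace false

open scoped BigOperators ComplexConjugate Real Topology
open Complex MeasureTheory Set Filter Finset

namespace Summit.RiemannHypothesis.RiemannHypothesis.Theorems.SignConeExactConeRigidity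

open Literature.NumberTheory.LFunctions
open Summit.RiemannHypothesis.RiemannHypothesis.Theorems.SignCone
open Summit.RiemannHypothesis.RiemannHypothesis.Theorems.RuelleBandCofiniteCriticalLine
open Literature.NumberTheory.LFunctions.WeilConverse

-- Local notation: the fake Weil form `𝔛[c, K] = W_ar(K) - P_c(K)` of a kernel `K`.
local notation3 (prettyPrint := false) "𝔛[" c ", " K "]" => weilPolarTerm K + weilArchTerm K -
  ∑' n : ℕ, ((c n : ℝ) : ℂ) / (Real.sqrt n : ℂ) * (K (Real.log n) + K (-Real.log n))

variable {g : ℝ → ℂ} {c : ℕ → ℝ} {κ : ℝ}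

/-! ## Linearity of `𝔛[c, ·]` over finite combinations -/

/-- `𝔛[c, Σᵢ mᵢ Kᵢ] = Σᵢ mᵢ 𝔛[c, Kᵢ]` for Weil test kernels `Kᵢ`. -/
theorem fakeForm_finset_sum_mul {ι : Type*} (s : Finset ι) (m : ι → ℂ) {K : ι → ℝ → ℂ}
    (hK : ∀ i ∈ s, IsWeilTest (K i)) :
    𝔛[c, fun t => ∑ i ∈ s, m i * K i t] = ∑ i ∈ s, m i * 𝔛[c, K i] := by
  have hK' : ∀ i ∈ s, IsWeilTest (fun t => m i * K i t) := fun i hi => (hK i hi).const_mul (m i)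
  have hW := weilArchPolar_finset_sum s hK'
  have hP := fakePrimeTerm_finset_sum c s (G := fun i t => m i * K i t) fun i hi => (hK' i hi).2
  rw [hW, hP, ← Finset.sum_sub_distrib]
  refine Finset.sum_congr rfl fun i _ => ?_
  have h := fakeForm_const_mul c (m i) (K i)
  linear_combination h

/-! ## Hermitian symmetry of the translate function -/

/-- `𝔛[c, K̃] = conj 𝔛[c, K]` (from `SignCone.fakeForm_weilReflect`, which carries the extra `+ K(0)`). -/
theorem fakeForm_weilReflect' (c : ℕ → ℝ) (K : ℝ → ℂ) :
    𝔛[c, weilReflect K] = conj 𝔛[c, K] := by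
  have h := fakeForm_weilReflect c K
  have h0 : weilReflect K 0 = conj (K 0) := by simp [weilReflect]
  rw [h0, map_add] at h
  exact add_right_cancel h

/-- **Hermitian symmetry**: with `G = g ⋆ g̃`, `a(-x) = conj a(x)` for
`a(x) = 𝔛[c, G(· - x)] + κ G(-x)`. -/
theorem fakeForm_translate_neg (c : ℕ → ℝ) (κ : ℝ) (g : ℝ → ℂ) (x : ℝ) :
    𝔛[c, weilTranslate (weilConv g (weilReflect g)) (-x)] +
        (κ : ℂ) * weilTranslate (weilConv g (weilReflect g)) (-x) 0 =
      conj (𝔛[c, weilTranslate (weilConv g (weilReflect g)) x] +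
        (κ : ℂ) * weilTranslate (weilConv g (weilReflect g)) x 0) := by
  have hsym : ∀ t, conj (weilConv g (weilReflect g) (-t)) = weilConv g (weilReflect g) t :=
    fun t => conj_weilConv_weilReflect_neg g t
  rw [← weilReflect_weilTranslate_of_selfAdjoint hsym x, fakeForm_weilReflect', map_add, map_mul,
    Complex.conj_ofReal]
  congr 1
  simp only [weilReflect, weilTranslate, neg_zero, zero_sub]

/-! ## Positive-definiteness of the translate function -/

/-- The autocorrelation of a finite comb of translates `Σⱼ zⱼ g(· - xⱼ)` is
`Σ_{(j,k)} zⱼ conj(z_k) G(· - (xⱼ - x_k))`, `G = g ⋆ g̃`. -/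
theorem weilConv_weilReflect_comb_translate (hg : IsWeilTest g) {ι : Type*} (s : Finset ι) (z : ι → ℂ)
    (x : ι → ℝ) :
    weilConv (fun t => ∑ i ∈ s, z i * weilTranslate g (x i) t)
        (weilReflect fun t => ∑ i ∈ s, z i * weilTranslate g (x i) t) =
      fun t => ∑ p ∈ s ×ˢ s, (z p.1 * conj (z p.2)) *
        weilTranslate (weilConv g (weilReflect g)) (x p.1 - x p.2) t := by
  rw [stub_branchesContinuous_weilConv_weilReflect_comb s z (fun i _ => hg.weilTranslate (x i))]
  funext t
  rw [Finset.sum_product, Finset.sum_comm]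
  refine Finset.sum_congr rfl fun k _ => ?_
  rw [Finset.mul_sum]
  refine Finset.sum_congr rfl fun j _ => ?_
  rw [weilConv_weilReflect_weilTranslate_left, weilConv_weilReflect_weilTranslate_right]
  simp only [weilTranslate]
  rw [show t - x j + x k = t - (x j - x k) by ring]
  ring

/-- **Positive-definiteness of the translate function.** If `c` is `κ`-slack feasible against every Weil
test, then for every Weil test `g` (`G = g ⋆ g̃`) and every finite family `(zⱼ, xⱼ)`,
`0 ≤ Re Σ_{j,k<N} zⱼ conj(z_k) a(xⱼ - x_k)`, `a(x) = 𝔛[c, G(· - x)] + κ G(-x)`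
(apply feasibility to the comb `Σⱼ zⱼ g(· - xⱼ)` and expand by linearity). -/
theorem re_sum_sum_fakeForm_translate_nonneg
    (hU : ∀ φ : ℝ → ℂ, IsWeilTest φ →
      -(κ * ∫ t, ‖φ t‖ ^ 2) ≤ (𝔛[c, weilConv φ (weilReflect φ)]).re)
    (hg : IsWeilTest g) (N : ℕ) (z : ℕ → ℂ) (x : ℕ → ℝ) :
    0 ≤ (∑ j ∈ range N, ∑ k ∈ range N, z j * conj (z k) *
      (𝔛[c, weilTranslate (weilConv g (weilReflect g)) (x j - x k)] +
        (κ : ℂ) * weilTranslate (weilConv g (weilReflect g)) (x j - x k) 0)).re := by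
  set G : ℝ → ℂ := weilConv g (weilReflect g) with hG
  have hGt : IsWeilTest G := hg.weilConv hg.weilReflect
  set φ : ℝ → ℂ := fun t => ∑ i ∈ range N, z i * weilTranslate g (x i) t with hφ
  have hφt : IsWeilTest φ := stub_branchesContinuous_isWeilTest_comb (range N) z fun i _ => hg.weilTranslate (x i)
  have hauto := weilConv_weilReflect_comb_translate hg (range N) z x
  have hK : ∀ p ∈ range N ×ˢ range N, IsWeilTest (weilTranslate G (x p.1 - x p.2)) :=
    fun p _ => hGt.weilTranslate _
  have hlin := fakeForm_finset_sum_mul (c := c) (range N ×ˢ range N) (fun p => z p.1 * conj (z p.2)) hK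
  have h := hU φ hφt
  have h0 : (∫ t, ‖φ t‖ ^ 2) = (weilConv φ (weilReflect φ) 0).re := by
    rw [weilConv_weilReflect_apply_zero, Complex.ofReal_re]
  rw [h0, hauto, hlin] at h
  -- `Re 𝔛 + κ Re K(0) ≥ 0`, i.e. `0 ≤ Re Σ_p m_p (𝔛[K_p] + κ K_p(0))`
  have hsum : ∑ j ∈ range N, ∑ k ∈ range N, z j * conj (z k) *
      (𝔛[c, weilTranslate G (x j - x k)] + (κ : ℂ) * weilTranslate G (x j - x k) 0) =
      ∑ p ∈ range N ×ˢ range N, z p.1 * conj (z p.2) * 𝔛[c, weilTranslate G (x p.1 - x p.2)] +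
        (κ : ℂ) * ∑ p ∈ range N ×ˢ range N, z p.1 * conj (z p.2) * weilTranslate G (x p.1 - x p.2) 0 := by
    rw [Finset.mul_sum, ← Finset.sum_add_distrib, Finset.sum_product]
    refine Finset.sum_congr rfl fun j _ => Finset.sum_congr rfl fun k _ => ?_
    ring
  rw [hsum, Complex.add_re, Complex.re_ofReal_mul]
  linarith

/-! ## Boundedness: the `γ`-trick for every slack -/

/-- **The translate function is bounded by its value at `0`.** If `c` is `κ`-slack feasible against every
Weil test then, for every Weil test `g` (`G = g ⋆ g̃`) and real `x`,
`‖𝔛[c, G(· - x)] + κ G(-x)‖ ≤ Re (𝔛[c, G] + κ G(0))` (as `SignCone.norm_fakeForm_weilTranslate_le`, which is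
the case `κ = 1`: expand `0 ≤ Re Φ` at the autocorrelation of `g + γ g_x`, `γ = -conj E/‖E‖`). -/
theorem norm_fakeForm_translate_le
    (hU : ∀ φ : ℝ → ℂ, IsWeilTest φ →
      -(κ * ∫ t, ‖φ t‖ ^ 2) ≤ (𝔛[c, weilConv φ (weilReflect φ)]).re)
    (hg : IsWeilTest g) (x : ℝ) :
    ‖𝔛[c, weilTranslate (weilConv g (weilReflect g)) x] +
        (κ : ℂ) * weilTranslate (weilConv g (weilReflect g)) x 0‖ ≤
      (𝔛[c, weilConv g (weilReflect g)] + (κ : ℂ) * weilConv g (weilReflect g) 0).re := by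
  set Φ : (ℝ → ℂ) → ℂ := fun K => 𝔛[c, K] + (κ : ℂ) * K 0 with hΦ
  set G : ℝ → ℂ := weilConv g (weilReflect g) with hG
  set Tp : ℝ → ℂ := weilTranslate G x with hTp
  set Tm : ℝ → ℂ := weilTranslate G (-x) with hTm
  have hGt : IsWeilTest G := hg.weilConv hg.weilReflect
  have hTpt : IsWeilTest Tp := hGt.weilTranslate x
  have hTmt : IsWeilTest Tm := hGt.weilTranslate (-x)
  -- positivity of `Re Φ` on autocorrelations
  have hpos : ∀ φ : ℝ → ℂ, IsWeilTest φ → 0 ≤ (Φ (weilConv φ (weilReflect φ))).re := by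
    intro φ hφ
    have h := hU φ hφ
    have h0 : (weilConv φ (weilReflect φ) 0).re = ∫ t, ‖φ t‖ ^ 2 := by
      rw [weilConv_weilReflect_apply_zero, Complex.ofReal_re]
    simp only [hΦ, Complex.add_re, Complex.re_ofReal_mul]
    rw [h0]
    linarith
  -- `Φ(Tm) = conj Φ(Tp)`
  have hrefl : Φ Tm = conj (Φ Tp) := fakeForm_translate_neg c κ g x
  -- the expansion `Φ(G_{g + γ g_x}) = (1 + |γ|²) Φ(G) + conj γ Φ(Tm) + γ Φ(Tp)`
  have hexp : ∀ γ : ℂ, Φ (weilConv (translateMix g γ x) (weilReflect (translateMix g γ x))) =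
      (1 + Complex.normSq γ) * Φ G + conj γ * Φ Tm + γ * Φ Tp := by
    intro γ
    have e : weilConv (translateMix g γ x) (weilReflect (translateMix g γ x)) =
        fun t => ∑ i : Fin 3, (![((1 + Complex.normSq γ : ℝ) : ℂ), conj γ, γ] i) * (![G, Tm, Tp] i) t := by
      funext t
      rw [weilConv_weilReflect_translateMix hg, Fin.sum_univ_three]
      simp only [Matrix.cons_val_zero, Matrix.cons_val_one, Matrix.cons_val, hTm, hTp, weilTranslate,
        sub_neg_eq_add, hG]
      push_cast
      ring
    have hK : ∀ i ∈ (Finset.univ : Finset (Fin 3)), IsWeilTest (![G, Tm, Tp] i) := by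
      intro i _
      fin_cases i
      · exact hGt
      · exact hTmt
      · exact hTpt
    have hlin := fakeForm_finset_sum_mul (c := c) Finset.univ
      (fun i => ![((1 + Complex.normSq γ : ℝ) : ℂ), conj γ, γ] i) hK
    simp only [hΦ]
    rw [e, hlin]
    simp only [Fin.sum_univ_three, Matrix.cons_val_zero, Matrix.cons_val_one, Matrix.cons_val]
    push_cast
    ring
  -- the `γ`-trick
  set E : ℂ := Φ Tp with hE
  by_cases hE0 : E = 0
  · have : Φ Tp = 0 := hE0
    show ‖Φ Tp‖ ≤ (Φ G).re
    rw [this, norm_zero]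
    exact hpos g hg
  have hn0 : ‖E‖ ≠ 0 := norm_ne_zero_iff.2 hE0
  have hn : (‖E‖ : ℂ) ≠ 0 := by exact_mod_cast hn0
  set γ : ℂ := -conj E / (‖E‖ : ℂ) with hγ
  have hγE : γ * E = -(‖E‖ : ℂ) := by
    rw [hγ, div_mul_eq_mul_div, neg_mul, Complex.conj_mul', neg_div]
    congr 1
    rw [sq, mul_div_assoc, div_self hn, mul_one]
  have hγ1 : Complex.normSq γ = 1 := by
    rw [Complex.normSq_eq_norm_sq, hγ, norm_div, norm_neg, Complex.norm_conj, Complex.norm_real,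
      Real.norm_eq_abs, abs_norm, div_self hn0, one_pow]
  have h0 := hpos _ (isWeilTest_translateMix hg γ x)
  rw [hexp γ, hrefl, ← map_mul, hγE, hγ1] at h0
  have key : (((1 : ℂ) + ((1 : ℝ) : ℂ)) * Φ G + conj (-((‖E‖ : ℝ) : ℂ)) + -((‖E‖ : ℝ) : ℂ)).re =
      2 * (Φ G).re - 2 * ‖E‖ := by
    simp [Complex.mul_re]
    ring
  rw [key] at h0
  show ‖E‖ ≤ (Φ G).re
  linarith

/-! ## Continuity of the translate function -/

/-- The polar-plus-archimedean part `x ↦ W_ar(K(· - x))` of a Weil test kernel `K` is continuous in `x`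
(`K̂_x(s) = e^{(s-1/2)x} K̂(s)`; dominated convergence in the archimedean integral). -/
theorem continuous_weilArchPolar_weilTranslate {K : ℝ → ℂ} (hK : IsWeilTest K) :
    Continuous fun x : ℝ => weilPolarTerm (weilTranslate K x) + weilArchTerm (weilTranslate K x) := by
  have hP : Continuous fun x : ℝ => weilPolarTerm (weilTranslate K x) := by
    have e : (fun x : ℝ => weilPolarTerm (weilTranslate K x)) = fun x : ℝ =>
        cexp ((0 - 1 / 2) * x) * weilMellin K 0 + cexp ((1 - 1 / 2) * x) * weilMellin K 1 := by
      funext x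
      simp only [weilPolarTerm, weilMellin_weilTranslate]
    rw [e]
    fun_prop
  have hI : Continuous fun x : ℝ => weilArchIntegral (weilTranslate K x) := by
    have e : (fun x : ℝ => weilArchIntegral (weilTranslate K x)) = fun x : ℝ =>
        ∫ t : ℝ, cexp ((1 / 2 + t * I - 1 / 2) * x) *
          (weilMellin K (1 / 2 + t * I) * ((Complex.digamma (1 / 4 + t / 2 * I)).re : ℂ)) := by
      funext x
      simp only [weilArchIntegral, weilMellin_weilTranslate, mul_assoc]
    rw [e]
    have hint := stub_branchesContinuous_integrable_weilArchIntegrand hK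
    refine continuous_of_dominated (bound := fun t => ‖weilMellin K (1 / 2 + t * I) *
        ((Complex.digamma (1 / 4 + t / 2 * I)).re : ℂ)‖) (fun x => ?_) (fun x => ?_) hint.norm ?_
    · exact (Continuous.aestronglyMeasurable (by fun_prop)).mul hint.aestronglyMeasurable
    · refine Eventually.of_forall fun t => ?_
      rw [norm_mul, Complex.norm_exp]
      have : ((1 / 2 + (t : ℂ) * I - 1 / 2) * (x : ℂ)).re = 0 := by
        simp
      rw [this, Real.exp_zero, one_mul]
    · exact Eventually.of_forall fun t => by fun_prop
  have hA : Continuous fun x : ℝ => weilArchTerm (weilTranslate K x) := by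
    have e : (fun x : ℝ => weilArchTerm (weilTranslate K x)) = fun x : ℝ =>
        (1 / (2 * π) : ℂ) * weilArchIntegral (weilTranslate K x) - K (0 - x) * (Real.log π : ℂ) := by
      funext x
      simp only [weilArchTerm, weilTranslate]
    rw [e]
    exact (continuous_const.mul hI).sub ((hK.1.continuous.comp (by fun_prop)).mul continuous_const)
  exact hP.add hA

/-- The fake prime part `x ↦ P_c(K(· - x))` of a compactly supported continuous kernel is continuous in `x`
(locally it is a FINITE sum of continuous functions: only the nodes `log n ≤ R + |x₀| + 1` enter near `x₀`). -/
theorem continuous_fakePrimeTerm_weilTranslate (c : ℕ → ℝ) {K : ℝ → ℂ} (hKc : Continuous K)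
    (hKs : HasCompactSupport K) :
    Continuous fun x : ℝ => ∑' n : ℕ, ((c n : ℝ) : ℂ) / (Real.sqrt n : ℂ) *
      (weilTranslate K x (Real.log n) + weilTranslate K x (-Real.log n)) := by
  obtain ⟨R, hR0, hR⟩ := WeilContinuous.exists_support_radius hKs
  refine continuous_iff_continuousAt.2 fun x₀ => ?_
  -- a uniform node range on the ball `|x - x₀| < 1`
  set N₀ : ℕ := ⌈Real.exp (R + |x₀| + 1)⌉₊ with hN₀
  have hvan : ∀ x : ℝ, |x - x₀| < 1 → ∀ n : ℕ, n ∉ Finset.range N₀ →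
      ((c n : ℝ) : ℂ) / (Real.sqrt n : ℂ) * (weilTranslate K x (Real.log n) + weilTranslate K x (-Real.log n)) = 0 := by
    intro x hx n hn
    rw [Finset.mem_range, not_lt] at hn
    have hn' : Real.exp (R + |x₀| + 1) ≤ n := (Nat.le_ceil _).trans (by exact_mod_cast hn)
    have hpos : (0 : ℝ) < n := (Real.exp_pos _).trans_le hn'
    have hlog : R + |x₀| + 1 ≤ Real.log n := by rwa [Real.le_log_iff_exp_le hpos]
    have hxx : |x| < |x₀| + 1 := by
      have := abs_sub_abs_le_abs_sub x x₀
      linarith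
    have h1 : R < |Real.log n - x| := by
      have := abs_sub_abs_le_abs_sub (Real.log n) x
      rw [abs_of_nonneg (Real.log_natCast_nonneg n)] at this
      linarith
    have h2 : R < |-Real.log n - x| := by
      rw [show -Real.log n - x = -(Real.log n + x) by ring, abs_neg]
      have := abs_add_le (Real.log n + x) (-x)
      rw [add_neg_cancel_right, abs_neg, abs_of_nonneg (Real.log_natCast_nonneg n)] at this
      linarith
    simp only [weilTranslate]
    rw [hR _ h1, hR _ h2, add_zero, mul_zero]
  have hloc : ∀ x : ℝ, |x - x₀| < 1 →
      (∑' n : ℕ, ((c n : ℝ) : ℂ) / (Real.sqrt n : ℂ) *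
        (weilTranslate K x (Real.log n) + weilTranslate K x (-Real.log n))) =
      ∑ n ∈ Finset.range N₀, ((c n : ℝ) : ℂ) / (Real.sqrt n : ℂ) *
        (weilTranslate K x (Real.log n) + weilTranslate K x (-Real.log n)) :=
    fun x hx => tsum_eq_sum (hvan x hx)
  have hfin : Continuous fun x : ℝ => ∑ n ∈ Finset.range N₀, ((c n : ℝ) : ℂ) / (Real.sqrt n : ℂ) *
      (weilTranslate K x (Real.log n) + weilTranslate K x (-Real.log n)) := by
    refine continuous_finsetSum _ fun n _ => continuous_const.mul ?_
    simp only [weilTranslate]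
    exact (hKc.comp (by fun_prop)).add (hKc.comp (by fun_prop))
  refine (hfin.continuousAt (x := x₀)).congr (Filter.eventuallyEq_of_mem (Metric.ball_mem_nhds x₀ one_pos)
    fun x hx => ?_)
  rw [Metric.mem_ball, Real.dist_eq] at hx
  exact (hloc x hx).symm

/-- **Continuity of the translate function** `x ↦ 𝔛[c, G(· - x)] + κ G(-x)` for a Weil test kernel `G`. -/
theorem continuous_fakeForm_translate (c : ℕ → ℝ) (κ : ℝ) {G : ℝ → ℂ} (hG : IsWeilTest G) :
    Continuous fun x : ℝ => 𝔛[c, weilTranslate G x] + (κ : ℂ) * weilTranslate G x 0 := by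
  have h1 := continuous_weilArchPolar_weilTranslate hG
  have h2 := continuous_fakePrimeTerm_weilTranslate c hG.1.continuous hG.2
  have h3 : Continuous fun x : ℝ => (κ : ℂ) * weilTranslate G x 0 := by
    simp only [weilTranslate]
    exact continuous_const.mul (hG.1.continuous.comp (by fun_prop))
  exact (h1.sub h2).add h3

/-! ## Carathéodory positivity -/

/-- **Carathéodory positivity of cone weights (archive 2001 fefr Thm A / A♭, Laplace form).** Let `c` be a
weight on `ℕ` that is `κ`-slack feasible against every Weil test:
`-κ‖φ‖₂² ≤ Re (W_ar(φ ⋆ φ̃) - Σₙ c(n) n^{-1/2}((φ ⋆ φ̃)(log n) + (φ ⋆ φ̃)(-log n)))` for all Weil tests `φ`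
(`κ = 0`: the exact cone `K`; `κ = 1`: the unit-slack cone `K♭`). Then for every Weil test `g`, `G = g ⋆ g̃`,
the Laplace transform of the translate function `a(x) = (W_ar - P_c)(G(· - x)) + κ G(-x)` has nonnegative
real part on the right half-plane: `0 ≤ Re ∫₀^∞ a(x) e^{-zx} dx` (`Re z > 0`). Proof: `a` is continuous,
bounded, hermitian and positive-definite (this file), and `re_laplace_nonneg_of_posDef`. -/
theorem re_laplace_fakeForm_translate_nonneg
    (hU : ∀ φ : ℝ → ℂ, IsWeilTest φ →
      -(κ * ∫ t, ‖φ t‖ ^ 2) ≤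
        (weilPolarTerm (weilConv φ (weilReflect φ)) + weilArchTerm (weilConv φ (weilReflect φ)) -
          ∑' n : ℕ, ((c n : ℝ) : ℂ) / (Real.sqrt n : ℂ) *
            (weilConv φ (weilReflect φ) (Real.log n) + weilConv φ (weilReflect φ) (-Real.log n))).re)
    (hg : IsWeilTest g) {z : ℂ} (hz : 0 < z.re) :
    0 ≤ (∫ x in Ioi (0 : ℝ),
      (weilPolarTerm (weilTranslate (weilConv g (weilReflect g)) x) +
          weilArchTerm (weilTranslate (weilConv g (weilReflect g)) x) -
          (∑' n : ℕ, ((c n : ℝ) : ℂ) / (Real.sqrt n : ℂ) *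
            (weilTranslate (weilConv g (weilReflect g)) x (Real.log n) +
              weilTranslate (weilConv g (weilReflect g)) x (-Real.log n))) +
        (κ : ℂ) * weilTranslate (weilConv g (weilReflect g)) x 0) * cexp (-(z * x))).re := by
  set a : ℝ → ℂ := fun x => 𝔛[c, weilTranslate (weilConv g (weilReflect g)) x] +
    (κ : ℂ) * weilTranslate (weilConv g (weilReflect g)) x 0 with ha
  have hGt : IsWeilTest (weilConv g (weilReflect g)) := hg.weilConv hg.weilReflect
  have hcont : Continuous a := continuous_fakeForm_translate c κ hGt
  have hB : ∀ x, ‖a x‖ ≤ (𝔛[c, weilConv g (weilReflect g)] + (κ : ℂ) * weilConv g (weilReflect g) 0).re :=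
    fun x => norm_fakeForm_translate_le hU hg x
  have hsymm : ∀ x, a (-x) = conj (a x) := fun x => fakeForm_translate_neg c κ g x
  have hpd : ∀ (N : ℕ) (w : ℕ → ℂ) (x : ℕ → ℝ),
      0 ≤ (∑ j ∈ range N, ∑ k ∈ range N, w j * conj (w k) * a (x j - x k)).re :=
    fun N w x => re_sum_sum_fakeForm_translate_nonneg hU hg N w x
  exact re_laplace_nonneg_of_posDef hcont hB hsymm hpd hz

end Summit.RiemannHypothesis.RiemannHypothesis.Theorems.SignConeExactConeRigidity
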